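import Summits.QuantumFields.YangMills.Theorems.LuscherReductionTwistedTraceScalingBODefectTailSchur
import Summits.QuantumFields.YangMills.Theorems.LuscherReductionTwistedTraceScalingBOProjection
import Summits.QuantumFields.YangMills.Theorems.LuscherReductionTwistedTraceScalingSlowDisintegrationTubes
import Summits.QuantumFields.YangMills.Theorems.LuscherReductionRunningReductionLatticeLinkKernel
import HarnessLib

/-!
# (C5-O, tools) THE SCHUR INSTANCE FOR THE GAUGE-AVERAGED KERNEL WITH A RESTRICTED COLUMN CONDITION, and the `L²` mass of a BO function with a sup-bounded profile
# (lane A of S-BASE, crux `TwistedTraceScaling` stmt-QuantumFields-20203, C4-CORE, the (OD) pen; tools for piece `I_out` of `…BODefectSplit`, `pub/ym-fleet/ym-luscher-20007-p1/HANDOFF-g20.md`)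

Piece `I_out = ∫ 𝟙_{S∖S_in}·F²/w` (`F = K̃(φ⊗Ω_c)`) of the hOD defect is bounded region by region by the weighted Schur test `…BODefectTailSchur.sq_integral_kernel_weight_le` with the
gauge-averaged kernel `K̃_β ≤ e^{2β|E|}`; the column condition is only available on the support of the transferred function (e.g. the STIFF-SEPARATION bound holds for `V` in the
inner gauge-near tube only), so the kernel is restricted to that support first:
* §1 `avgKernel_le_expCard` — `K̃_β(U,V) ≤ e^{2β|E|}` (`β ≥ 0`);
* §2 ★★ `schur_avgKernel_restricted_le` — `g ≥ 0` bounded measurable, `f` bounded measurable supported in a measurable `V_s`, `∫ K̃(U,V)g(U)dU ≤ G` for `V ∈ V_s` (`G ≥ 0`):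
  `∫ g·(K̃f)² ≤ e^{2β|E|}·G·∫f²`;
* §3 ★ `sq_integral_boFun_le` — `Ω'² ≤ C` on cap-balanced fibre vectors ⇒ `∫ (boFun φ Ω')² ≤ π(univ)·C·∫φ²` (exact tube disintegration `…SlowDisintegrationTubes`).
HONEST FRAMING: bookkeeping for a stub of a child of the CONDITIONAL route R2b1; (C5)-out proper (stiff separation), the hOD assembly, (B-ST), C4-CORE OPEN; not a gap, not Clay.
-/

set_option autoImplicit false

noncomputable section

open MeasureTheory Filter Topology Real
open scoped BigOperators
open Literature.MathematicalPhysics.QuantumFieldTheory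
open Literature.MathematicalPhysics.QuantumLattice

namespace Summit.QuantumFields.YangMills.Theorems.FemtoTransferGap.TwoLattice.ConstTube

open Summit.QuantumFields.YangMills.Theorems.FemtoTransferGap
open Summit.QuantumFields.YangMills.Theorems.FemtoTransferGap.TwoLattice
open Summit.QuantumFields.YangMills.Theorems.FemtoTransferGap.TwoLattice.Avg
open Summit.QuantumFields.YangMills.Theorems.FemtoTransferGap.TwoLattice.Stiff (LinkSpace)

variable {L : ℕ} [NeZero L]

/-! ## §1 The averaged kernel is bounded by `e^{2β|E|}` -/

/-- `K̃_β(U,V) ≤ e^{2β|E|}` for `β ≥ 0`. [folklore] -/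
theorem avgKernel_le_expCard {β : ℝ} (hβ : 0 ≤ β) (U V : GaugeConfig 3 L SU2) : avgKernel β U V ≤ Real.exp (2 * β) ^ Fintype.card (Edge 3 L) :=
  avgKernel_le β (fun U' V' => (le_abs_self _).trans (abs_transferKernel_le_lat hβ (U', V'))) U V

/-! ## §2 ★★ The Schur instance with a restricted column condition -/

/-- ★★ **SCHUR FOR `K̃_β` WITH THE COLUMN CONDITION ON THE SUPPORT OF `f` ONLY.**  `g ≥ 0` bounded measurable, `f` bounded measurable with `supp f ⊆ V_s` (measurable), and
`∫ K̃_β(U,V)·g(U) dU ≤ G` for every `V ∈ V_s` (`G ≥ 0`, `β ≥ 0`):  `∫ g(U)·(∫ K̃_β(U,V)f(V)dV)² dU ≤ e^{2β|E|}·G·∫ f²`. [cite: Helffer2013, Lemma 7.1] -/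
theorem schur_avgKernel_restricted_le {β : ℝ} (hβ : 0 ≤ β) {g : GaugeConfig 3 L SU2 → ℝ} (hg : Measurable g) {Cg : ℝ} (hCg : ∀ U, |g U| ≤ Cg) (hg0 : ∀ U, 0 ≤ g U)
    {f : GaugeConfig 3 L SU2 → ℝ} (hf : Measurable f) {Cf : ℝ} (hCf : ∀ V, |f V| ≤ Cf) {Vs : Set (GaugeConfig 3 L SU2)} (hVs : MeasurableSet Vs)
    (hfV : ∀ V, f V ≠ 0 → V ∈ Vs) {G : ℝ} (hG : 0 ≤ G) (hcol : ∀ V ∈ Vs, ∫ U, avgKernel β U V * g U ∂configMeasure SU2 L ≤ G) :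
    ∫ U, g U * (∫ V, avgKernel β U V * f V ∂configMeasure SU2 L) ^ 2 ∂configMeasure SU2 L ≤
      Real.exp (2 * β) ^ Fintype.card (Edge 3 L) * G * ∫ V, f V ^ 2 ∂configMeasure SU2 L := by
  set EK : ℝ := Real.exp (2 * β) ^ Fintype.card (Edge 3 L) with hEK
  have hEK0 : 0 ≤ EK := by positivity
  set k : GaugeConfig 3 L SU2 → GaugeConfig 3 L SU2 → ℝ := fun U V => avgKernel β U V * Vs.indicator (fun _ => (1 : ℝ)) V with hkdef
  have hind1 : ∀ V, Vs.indicator (fun _ => (1 : ℝ)) V ≤ 1 := fun V => by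
    by_cases h : V ∈ Vs
    · rw [Set.indicator_of_mem h]
    · rw [Set.indicator_of_notMem h]; exact zero_le_one
  have hind0 : ∀ V, 0 ≤ Vs.indicator (fun _ => (1 : ℝ)) V := fun V => Set.indicator_nonneg (fun _ _ => zero_le_one) _
  have hk0 : ∀ U V, 0 ≤ k U V := fun U V => mul_nonneg (avgKernel_pos β U V).le (hind0 V)
  have hkle : ∀ U V, k U V ≤ EK := fun U V => by
    calc k U V ≤ EK * 1 := mul_le_mul (avgKernel_le_expCard hβ U V) (hind1 V) (hind0 V) hEK0
      _ = EK := mul_one _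
  have hCk : ∀ U V, |k U V| ≤ EK := fun U V => by rw [abs_of_nonneg (hk0 U V)]; exact hkle U V
  have hkm : Measurable (Function.uncurry k) := by
    have h : Measurable fun p : GaugeConfig 3 L SU2 × GaugeConfig 3 L SU2 => avgKernel β p.1 p.2 * Vs.indicator (fun _ => (1 : ℝ)) p.2 :=
      (measurable_avgKernel β).mul ((measurable_const.indicator hVs).comp measurable_snd)
    exact h
  -- `K̃f = k f`
  have hKf : ∀ U, ∫ V, avgKernel β U V * f V ∂configMeasure SU2 L = ∫ V, k U V * f V ∂configMeasure SU2 L := fun U => by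
    refine integral_congr_ae (ae_of_all _ fun V => ?_)
    dsimp only; rw [hkdef]; dsimp only
    by_cases hV : V ∈ Vs
    · rw [Set.indicator_of_mem hV, mul_one]
    · have hf0 : f V = 0 := by by_contra h; exact hV (hfV V h)
      rw [hf0, mul_zero, mul_zero]
  have hrow : ∀ U, ∫ V, k U V ∂configMeasure SU2 L ≤ EK := fun U => by
    have h := integral_mono_of_nonneg (μ := configMeasure SU2 L) (ae_of_all _ fun V => hk0 U V) (integrable_const EK) (ae_of_all _ fun V => hkle U V)
    simpa [integral_const] using h
  have hcol' : ∀ V, ∫ U, k U V * g U ∂configMeasure SU2 L ≤ G := fun V => by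
    rw [hkdef]; dsimp only
    by_cases hV : V ∈ Vs
    · simp_rw [Set.indicator_of_mem hV, mul_one]; exact hcol V hV
    · simp_rw [Set.indicator_of_notMem hV, mul_zero, zero_mul, integral_zero]; exact hG
  have h := sq_integral_kernel_weight_le (configMeasure SU2 L) hkm hCk hk0 hg hCg hg0 hf hCf hEK0 hrow hcol'
  simp_rw [← hKf] at h
  exact h

/-! ## §3 ★ The `L²` mass of a BO function with a sup-bounded profile -/

/-- ★ **`∫ (boFun φ Ω')² ≤ π(univ)·C·∫φ²`** when `Ω'(v̂)² ≤ C` for every cap-balanced `v` (`C ≥ 0`; bounded measurable data). [folklore] -/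
theorem sq_integral_boFun_le {φ : GaugeConfig 3 1 SU2 → ℝ} (hφm : Measurable φ) {Cφ : ℝ} (hCφ : ∀ u, |φ u| ≤ Cφ) {Ω' : LinkSpace L → ℝ} (hΩm : Measurable Ω')
    {CΩ : ℝ} (hCΩ : ∀ x, |Ω' x| ≤ CΩ) {C : ℝ} (hC0 : 0 ≤ C) (hC : ∀ v ∈ capBalancedSet L, Ω' (linkEmbed L v) ^ 2 ≤ C) :
    ∫ U, boFun L φ Ω' U ^ 2 ∂configMeasure SU2 L ≤ (orthoTransverse L Set.univ).toReal * C * ∫ u, φ u ^ 2 ∂configMeasure SU2 1 := by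
  haveI := isFiniteMeasure_orthoTransverse L
  set H : GaugeConfig 3 L SU2 → ℝ := fun U => (orthoTubeSet L).indicator (fun _ => (1 : ℝ)) U * (C * φ (slowMean L U) ^ 2) with hHdef
  have hbm : Measurable (boFun L φ Ω') := measurable_boFun L hφm hΩm
  have hbb : ∀ U, |boFun L φ Ω' U| ≤ Cφ * CΩ := fun U => abs_boFun_le L hCφ hCΩ U
  have hGi : Integrable (fun U => boFun L φ Ω' U ^ 2) (configMeasure SU2 L) :=
    integrable_of_measurable_abs_le _ (hbm.pow_const 2) (C := (Cφ * CΩ) ^ 2) fun U => by rw [abs_pow]; exact pow_le_pow_left₀ (abs_nonneg _) (hbb U) 2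
  have hHm : Measurable H := by
    rw [hHdef]; exact (measurable_const.indicator (measurableSet_orthoTubeSet L)).mul (measurable_const.mul ((hφm.comp (measurable_slowMean L)).pow_const 2))
  have hHb : ∀ U, |H U| ≤ C * Cφ ^ 2 := fun U => by
    rw [hHdef]; dsimp only
    have hin : (orthoTubeSet L).indicator (fun _ => (1 : ℝ)) U ≤ 1 := by
      by_cases h : U ∈ orthoTubeSet L
      · rw [Set.indicator_of_mem h]
      · rw [Set.indicator_of_notMem h]; exact zero_le_one
    have hin0 : 0 ≤ (orthoTubeSet L).indicator (fun _ => (1 : ℝ)) U := Set.indicator_nonneg (fun _ _ => zero_le_one) _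
    rw [abs_mul, abs_of_nonneg hin0, abs_mul, abs_of_nonneg hC0, abs_pow]
    calc _ ≤ 1 * (C * Cφ ^ 2) := mul_le_mul hin (mul_le_mul_of_nonneg_left (pow_le_pow_left₀ (abs_nonneg _) (hCφ _) 2) hC0) (by positivity) zero_le_one
      _ = _ := one_mul _
  have hHi : Integrable H (configMeasure SU2 L) := integrable_of_measurable_abs_le _ hHm hHb
  have hGH : ∀ U, boFun L φ Ω' U ^ 2 ≤ H U := fun U => by
    rw [hHdef]; dsimp only
    by_cases hU : U ∈ orthoTubeSet L
    · have hU' := hU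
      obtain ⟨u, v, hv, rfl⟩ := hU'
      rw [Set.indicator_of_mem hU, one_mul, boFun_orthoTube L φ Ω' u hv, slowMean_orthoTube L u hv, mul_pow]
      calc φ u ^ 2 * Ω' (linkEmbed L v) ^ 2 ≤ φ u ^ 2 * C := mul_le_mul_of_nonneg_left (hC v hv) (sq_nonneg _)
        _ = C * φ u ^ 2 := mul_comm _ _
    · rw [boFun_eq_zero_of_not_mem L φ Ω' hU, Set.indicator_of_notMem hU]; simp
  have hH0 : ∀ U, U ∉ orthoTubeSet L → H U = 0 := fun U hU => by rw [hHdef]; dsimp only; rw [Set.indicator_of_notMem hU, zero_mul]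
  have hHslow : ∀ (u : GaugeConfig 3 1 SU2) (v : Edge 3 L → Fin 3 → ℝ), v ∈ capBalancedSet L → H (orthoTube L u v) = C * φ u ^ 2 := fun u v hv => by
    rw [hHdef]; dsimp only; rw [Set.indicator_of_mem (orthoTube_mem L u hv), one_mul, slowMean_orthoTube L u hv]
  have hIH := integral_configMeasure_orthoTube_of_slow L hHm ⟨C * Cφ ^ 2, hHb⟩ hH0 hHslow
  calc ∫ U, boFun L φ Ω' U ^ 2 ∂configMeasure SU2 L ≤ ∫ U, H U ∂configMeasure SU2 L := integral_mono hGi hHi hGH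
    _ = (orthoTransverse L Set.univ).toReal * ∫ u, C * φ u ^ 2 ∂configMeasure SU2 1 := hIH
    _ = _ := by rw [integral_const_mul]; ring

end Summit.QuantumFields.YangMills.Theorems.FemtoTransferGap.TwoLattice.ConstTube

end
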